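/-
Copyright: statement-level skeleton of a published paper (lit-balaban cell, Phase-2 proof seat p25, gen 19). No proof
claims beyond what the kernel checks below.
-/
import Literature.MathematicalPhysics.QuantumFieldTheory.BalabanImbrieJaffe1984to88.BIJ88WalkRemainderExpectation312

/-!
# `BalabanImbrieJaffe1984to88.BIJ88WalkScaledCutoff309` — T. Bałaban, J. Imbrie, A. Jaffe, *Effective action and
cluster properties of the abelian Higgs model*, Commun. Math. Phys. **114** (1988) 257–315 [BalabanImbrieJaffe1988],
§5.14 p. 309 [PDF 53], verbatim (x2 render `lit-balaban-r16/renders/cmp114/original-p053-x2.png`): *"Each t-derivative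
of a χ-factor in χ_{Λ₁₂^{(k)},t} gives at least a factor e^β(L^kε/ε₀)^{1/4−α}. This follows because with
χ′(1, x) ≡ d/dxχ(1, x), we have |d/dt χ(cp(te_k), A^{(k)})| = |A^{(k)}/cp(te_k)² (d/dt p(te_k)) χ′(1, A^{(k)}/cp(te_k))|
≤ ct^{−1}|χ′(1, A^{(k)}/cp(te_k))|, and similarly the n-th derivative in t of χ(cp(e_k), A^{(k)}) is bounded by t^{−n}
times a function bounded by a constant"* — **THE CHAIN RULE FOR A SCALED CUTOFF: EACH DIRECTIONAL DERIVATIVE OF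
`χ(Φ/p)` COSTS A FACTOR `1/p`** (p25 gen 19): print's cutoff is the unit cutoff evaluated at the rescaled field,
`χ(p, A) = χ(1, A/p)`; for the field derivatives of the integration by parts this gives
`(Π_{z∈D}∂_z)[h(Φ/p)] = p^{−|D|}·((Π_{z∈D}∂_z)h)(Φ/p)` (`dlist_comp_smul`), the multilinear sup bound
`|(Π_{z∈D}∂_z)h| ≤ (sup‖D^{|D|}h‖)·Π_{z∈D}‖z‖` (`abs_dlist_le_of_iteratedFDeriv`, from gen 4's
`BIJ88WickDerivatives305.norm_iteratedFDeriv_fderiv_apply_le`), whence the sup hypothesis of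
`BIJ88WalkRemainderExpectation312` with `η_χ = 1/p`: `|(Π_D∂)[h(Φ/p)]·e^{−V}| ≤ K·K_V·Π_{z∈D}(p^{−1}‖z‖)` for
`|D| ≤ N` (`scaled_cutoff_bound`; `K` bounds `‖D^nh‖`, `n ≤ N`, `K_V` bounds `e^{−V}`), and the expectation bound of
the located remainder terms for the scaled cutoff (`remainder_expectation_le_scaled`).

statement-level skeleton of published theorems with citation tags; proofs where landed; nothing here is a claim
about the Yang–Mills mass gap

PDF held: `paper:balaban1988-cmp114-bij-abelian-higgs-effective-action` (journal page = PDF page + 256); p. 309 =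
PDF 53 (x2 render re-read this session, 2026-08-23).

CITATION HEADER (lean-in-tree rule).  lit-balaban cell (HOME `run/shared/lean/pub/lit-balaban/`), Phase 2, seat p25
gen 19; row **C2.Claim@312** of `HOME/lit-balaban-r16/ROWS-C2-part2.md` (owner r16, referee ref-5; head
`BIJ88Sect5StatementsPart4.Ineq312` untouched — MEMBER of the row; serves clause (H2), the `η_χ` input).  USED BY
NAME, nothing restated: `BIJ88WickDerivatives305.{dlist, contDiff_fderiv_apply_const, norm_iteratedFDeriv_fderiv_apply_le}`
(p25 gen 4), `BIJ88IbpLeibniz312.dlist_contDiff`, `BIJ88VertexIbp311.{vexp, continuous_vexp}`,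
`BIJ88WalkRemainderExpectation312.abs_integral_fieldLaw_le_sup` (p25 gen 19), `BIJ88WalkExpansion311.expand`,
`BIJ88SlotMomentsGauss308.fieldLaw`.

## What is proved (0 `sorry`, standard axioms, no new `Prop` facts; theorems only)

* §1 `fderiv_comp_smul_apply`, `dlist_const_mul`, **`dlist_comp_smul`**, **`abs_dlist_le_of_iteratedFDeriv`**.
* §2 **`scaled_cutoff_bound`**; §3 **`remainder_expectation_le_scaled`** (on the §5.13 law).
HONEST SCOPE: (a) `1/p` per `χ′`-direction is the CHAIN-RULE smallness of print's p. 309 line; print's further gain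
— the derivative is *"supported in c₁p(te_k) ≤ |A^{(k)}| ≤ c₂p(te_k). After integration over A^{(k)}, we obtain
factors ct^{−n}e^{−cp(te_k)²}"* — is the shell mechanism of gen 17–18 (`abs_remTerm_le_shell`), not combined here;
(b) the bounds `K` (on `‖D^nh‖`, `n ≤ N`), `K_V` (on `e^{−V}`), the cap `N` on the number of `χ′`-directions of a
remainder term and the moments `Λ` are hypotheses; (c) nothing else of the row is touched.  NOT summit progress; NOT
continuum; NOT Clay.  Imports `BIJ88WalkRemainderExpectation312`; modifies nothing.
-/

noncomputable section

namespace Literature.MathematicalPhysics.QuantumFieldTheory.BalabanImbrieJaffe1984to88.BIJ88WalkScaledCutoff309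

open Classical MeasureTheory Matrix Finset Filter
open scoped BigOperators ContDiff Topology
open Literature.MathematicalPhysics.QuantumFieldTheory.Balaban1983to89
open BIJ88PolymerRep5134 (corner)
open BIJ88PolymerRep5134Gauss (prec src)
open BIJ88SlotMomentsGauss308 (fieldLaw)
open BIJ88VertexIbp311 (vexp continuous_vexp)
open BIJ88WickDerivatives305 (dlist dlist_nil dlist_cons contDiff_fderiv_apply_const norm_iteratedFDeriv_fderiv_apply_le)
open BIJ88IbpLeibniz312 (dlist_contDiff)
open BIJ88WalkRun311 BIJ88WalkExpansion311 BIJ88WalkRemainderExpectation312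

/-! ## §1  The chain rule for a scaled argument and the multilinear sup bound -/

section Calculus

variable {S : Type} [Fintype S]

/-- Chain rule: `∂_u[h(a·Φ)](Φ) = a·(∂_uh)(a·Φ)`. [cite: BalabanImbrieJaffe1988, §5.14 p.309] -/
theorem fderiv_comp_smul_apply {h : (S → ℝ) → ℝ} (hh : ContDiff ℝ ∞ h) (a : ℝ) (φ u : S → ℝ) :
    fderiv ℝ (fun ψ => h (a • ψ)) φ u = a * fderiv ℝ h (a • φ) u := by
  have hs : HasFDerivAt (fun ψ : S → ℝ => a • ψ) (a • ContinuousLinearMap.id ℝ (S → ℝ)) φ :=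
    (hasFDerivAt_id φ).const_smul a
  have hd : HasFDerivAt h (fderiv ℝ h (a • φ)) (a • φ) := (hh.differentiable (by simp) _).hasFDerivAt
  have hc : HasFDerivAt (fun ψ : S → ℝ => h (a • ψ)) ((fderiv ℝ h (a • φ)).comp (a • ContinuousLinearMap.id ℝ (S → ℝ))) φ :=
    hd.comp φ hs
  rw [hc.fderiv, ContinuousLinearMap.comp_apply, _root_.smul_apply,
    ContinuousLinearMap.id_apply, map_smul, smul_eq_mul]

/-- `(Π_D∂)(a·G) = a·(Π_D∂)G` for smooth `G`. [cite: BalabanImbrieJaffe1988, §5.14 p.309] -/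
theorem dlist_const_mul : ∀ (D : List (S → ℝ)) {G : (S → ℝ) → ℝ}, ContDiff ℝ ∞ G → ∀ a : ℝ,
    dlist D (fun φ => a * G φ) = fun φ => a * dlist D G φ
  | [], _, _, _ => rfl
  | u :: D, G, hG, a => by
    rw [dlist_cons, dlist_cons]
    have e : (fun φ => fderiv ℝ (fun φ => a * G φ) φ u) = fun φ => a * fderiv ℝ G φ u := by
      funext φ
      rw [((hG.differentiable (by simp) φ).hasFDerivAt.const_mul a).fderiv, _root_.smul_apply,
        smul_eq_mul]
    rw [e]
    exact dlist_const_mul D (contDiff_fderiv_apply_const hG u) a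

/-- **THE CHAIN RULE FOR A SCALED CUTOFF**: `(Π_{z∈D}∂_z)[h(a·Φ)](Φ) = a^{|D|}·((Π_{z∈D}∂_z)h)(a·Φ)` — each field
derivative of the cutoff at scale `p = 1/a` costs a factor `1/p` (print: *"|d/dt χ(cp(te_k), A^{(k)})| = |A^{(k)}/cp(te_k)²
(d/dt p(te_k)) χ′(1, A^{(k)}/cp(te_k))|"*). [cite: BalabanImbrieJaffe1988, §5.14 p.309] -/
theorem dlist_comp_smul : ∀ (D : List (S → ℝ)) {h : (S → ℝ) → ℝ}, ContDiff ℝ ∞ h → ∀ a : ℝ,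
    dlist D (fun φ => h (a • φ)) = fun φ => a ^ D.length * dlist D h (a • φ)
  | [], _, _, _ => by funext φ; simp
  | u :: D, h, hh, a => by
    rw [dlist_cons, dlist_cons]
    have e : (fun φ => fderiv ℝ (fun ψ => h (a • ψ)) φ u) = fun φ => a * fderiv ℝ h (a • φ) u := by
      funext φ; exact fderiv_comp_smul_apply hh a φ u
    have hg : ContDiff ℝ ∞ fun φ : S → ℝ => fderiv ℝ h (a • φ) u :=
      (contDiff_fderiv_apply_const hh u).comp (contDiff_const_smul a)
    have e2 : dlist D (fun φ => a * fderiv ℝ h (a • φ) u) = fun φ => a * dlist D (fun φ => fderiv ℝ h (a • φ) u) φ :=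
      dlist_const_mul D (G := fun φ => fderiv ℝ h (a • φ) u) hg a
    have e3 : dlist D (fun φ => fderiv ℝ h (a • φ) u) = fun φ => a ^ D.length * dlist D (fun ψ => fderiv ℝ h ψ u) (a • φ) :=
      dlist_comp_smul D (h := fun ψ => fderiv ℝ h ψ u) (contDiff_fderiv_apply_const hh u) a
    rw [e, e2, e3]
    funext φ
    simp only [List.length_cons, pow_succ]
    ring

/-- **THE MULTILINEAR SUP BOUND**: if `‖D^{|D|}h‖ ≤ K` everywhere then `|(Π_{z∈D}∂_z)h(ψ)| ≤ K·Π_{z∈D}‖z‖` (by gen 4's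
bound transfer `‖D^k(∂_uh)‖ ≤ ‖u‖·‖D^{k+1}h‖`). [cite: BalabanImbrieJaffe1988, §5.14 p.309] -/
theorem abs_dlist_le_of_iteratedFDeriv : ∀ (D : List (S → ℝ)) {h : (S → ℝ) → ℝ}, ContDiff ℝ ∞ h → ∀ {K : ℝ},
    (∀ φ, ‖iteratedFDeriv ℝ D.length h φ‖ ≤ K) → ∀ ψ, |dlist D h ψ| ≤ K * (D.map fun z => ‖z‖).prod
  | [], h, _, K, hK, ψ => by
    have := hK ψ
    rw [List.length_nil, norm_iteratedFDeriv_zero] at this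
    simpa using this
  | u :: D, h, hh, K, hK, ψ => by
    rw [dlist_cons, List.map_cons, List.prod_cons]
    have hK' : ∀ φ, ‖iteratedFDeriv ℝ D.length (fun ψ : S → ℝ => fderiv ℝ h ψ u) φ‖ ≤ ‖u‖ * K := fun φ =>
      (norm_iteratedFDeriv_fderiv_apply_le hh u D.length φ).trans
        (mul_le_mul_of_nonneg_left (hK φ) (norm_nonneg u))
    have h1 := abs_dlist_le_of_iteratedFDeriv D (contDiff_fderiv_apply_const hh u) hK' ψ
    calc |dlist D (fun φ => fderiv ℝ h φ u) ψ| ≤ ‖u‖ * K * (D.map fun z => ‖z‖).prod := h1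
      _ = K * (‖u‖ * (D.map fun z => ‖z‖).prod) := by ring

end Calculus

/-! ## §2  The sup hypothesis of the remainder bound for a scaled cutoff, `η_χ = 1/p` -/

section Scaled

variable {S : Type} [Fintype S] {ι : Type} [Fintype ι]

/-- **EACH `χ′`-DIRECTION COSTS `1/p`**: for a smooth unit cutoff `h` with `‖D^nh‖ ≤ K` (`n ≤ N`), an interaction factor
`|e^{−V}| ≤ K_V` and a scale `p > 0`, the cutoff `χ(Φ) = h(Φ/p)` satisfies
`|(Π_{z∈D}∂_z)χ(Φ)·e^{−V(Φ)}| ≤ K·K_V·Π_{z∈D}(p^{−1}‖z‖)` for every list of at most `N` directions.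
[cite: BalabanImbrieJaffe1988, §5.14 p.309] -/
theorem scaled_cutoff_bound {h : (S → ℝ) → ℝ} (hh : ContDiff ℝ ∞ h) {K KV p : ℝ} {N : ℕ} (hK0 : 0 ≤ K)
    (hK : ∀ n ≤ N, ∀ φ, ‖iteratedFDeriv ℝ n h φ‖ ≤ K) (c : ι → ℝ) (legs : ι → List (S → ℝ))
    (hV : ∀ φ, |vexp c legs φ| ≤ KV) (hp : 0 < p) :
    ∀ D : List (S → ℝ), D.length ≤ N → ∀ φ,
      |dlist D (fun ψ => h (p⁻¹ • ψ)) φ * vexp c legs φ| ≤ K * KV * (D.map fun z => p⁻¹ * ‖z‖).prod := by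
  intro D hD φ
  have hprod : (D.map fun z => p⁻¹ * ‖z‖).prod = p⁻¹ ^ D.length * (D.map fun z => ‖z‖).prod := by
    rw [List.prod_map_mul, List.map_const', List.prod_replicate]
  have h0 : 0 ≤ (D.map fun z : S → ℝ => ‖z‖).prod :=
    List.prod_nonneg fun x hx => by obtain ⟨z, -, rfl⟩ := List.mem_map.1 hx; exact norm_nonneg z
  have h1 : |dlist D h (p⁻¹ • φ)| ≤ K * (D.map fun z => ‖z‖).prod :=
    abs_dlist_le_of_iteratedFDeriv D hh (hK D.length hD) _
  rw [dlist_comp_smul D hh, abs_mul, abs_mul, abs_of_nonneg (pow_nonneg (inv_nonneg.2 hp.le) _), hprod]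
  have hKV : 0 ≤ KV := (abs_nonneg _).trans (hV φ)
  calc p⁻¹ ^ D.length * |dlist D h (p⁻¹ • φ)| * |vexp c legs φ|
      ≤ p⁻¹ ^ D.length * (K * (D.map fun z => ‖z‖).prod) * KV :=
        mul_le_mul (mul_le_mul_of_nonneg_left h1 (pow_nonneg (inv_nonneg.2 hp.le) _)) (hV φ) (abs_nonneg _)
          (mul_nonneg (pow_nonneg (inv_nonneg.2 hp.le) _) (mul_nonneg hK0 h0))
    _ = K * KV * (p⁻¹ ^ D.length * (D.map fun z => ‖z‖).prod) := by ring

end Scaled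

/-! ## §3  On the law of the §5.13 model -/

section Law

variable {ι : Type} [Fintype ι] {κ : Type} [LinearOrder κ] {P : Type} [Fintype P]
variable {α I : Type} [Fintype α] [DecidableEq α] [Fintype I] [DecidableEq I]
  {blk : α → I} {Δ : Matrix α α ℝ} {ℱ : α → ℝ} {W : Finset I}

/-- **THE EXPECTATION BOUND OF THE REMAINDER TERMS FOR A SCALED CUTOFF** (`η_χ = 1/p`): with `χ(Φ) = h(Φ/p)` as in
`scaled_cutoff_bound`, at most `N` `χ′`-directions per remainder term of `expand 0 O`, and the moment bound
`𝔼_W|Π_{legs}Φ| ≤ Λ`, every remainder term obeys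
`|𝔼_W[Π_{legs}Φ·(Π_{dirs t}∂)χ·e^{−V}]| ≤ (K·K_V)·Π_{z∈dirs t}(p^{−1}‖z‖)·Λ` — the hypothesis `hE` of
`BIJ88WalkRemainderActivity312.abs_remAt_div_le` with `K_χ = K·K_V`, `η_χ = 1/p`. [cite: BalabanImbrieJaffe1988, §5.14 p.309, 312] -/
theorem remainder_expectation_le_scaled (hPD : (prec blk Δ W (corner ℝ W)).PosDef)
    {Cov : P → Matrix {x : α // blk x ∈ W} {x : α // blk x ∈ W} ℝ} {trig : P → Bool} {c : ι → ℝ}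
    {legs : ι → List ({x : α // blk x ∈ W} → ℝ)} {obs : κ → List ({x : α // blk x ∈ W} → ℝ)} {M : ℕ}
    {h : ({x : α // blk x ∈ W} → ℝ) → ℝ} (hh : ContDiff ℝ ∞ h) {K KV p Λ : ℝ} {N : ℕ} (hK0 : 0 ≤ K)
    (hK : ∀ n ≤ N, ∀ φ, ‖iteratedFDeriv ℝ n h φ‖ ≤ K) (hV : ∀ φ, |vexp c legs φ| ≤ KV) (hp : 0 < p)
    {O : Finset κ} (hN : ∀ t ∈ expand Cov trig (src blk ℱ W) c legs obs M 0 O, t.consts = 0 → t.dirs.length ≤ N)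
    (hmom : ∀ t ∈ expand Cov trig (src blk ℱ W) c legs obs M 0 O, t.consts = 0 →
      ∫ φ, |((t.groups.map fun g => (g.pend : Multiset _)).sum.map fun w => φ ⬝ᵥ w).prod| ∂(fieldLaw blk Δ ℱ W) ≤ Λ) :
    ∀ t ∈ expand Cov trig (src blk ℱ W) c legs obs M 0 O, t.consts = 0 →
      |∫ φ, ((t.groups.map fun g => (g.pend : Multiset _)).sum.map fun w => φ ⬝ᵥ w).prod
          * (dlist t.dirs (fun ψ => h (p⁻¹ • ψ)) φ * vexp c legs φ) ∂(fieldLaw blk Δ ℱ W)|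
        ≤ K * KV * (t.dirs.map fun z => p⁻¹ * ‖z‖).prod * Λ := by
  intro t ht hc
  have hKV : 0 ≤ KV := (abs_nonneg _).trans (hV 0)
  have hKD : 0 ≤ K * KV * (t.dirs.map fun z => p⁻¹ * ‖z‖).prod :=
    mul_nonneg (mul_nonneg hK0 hKV) (List.prod_nonneg fun x hx => by
      obtain ⟨z, -, rfl⟩ := List.mem_map.1 hx; exact mul_nonneg (inv_nonneg.2 hp.le) (norm_nonneg z))
  have hχc : Continuous (dlist t.dirs fun ψ : {x : α // blk x ∈ W} → ℝ => h (p⁻¹ • ψ)) :=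
    (dlist_contDiff t.dirs (hh.comp (contDiff_const_smul p⁻¹))).continuous
  have h1 := abs_integral_fieldLaw_le_sup (ℱ := ℱ) hPD (hχc.mul (continuous_vexp c legs))
    (scaled_cutoff_bound hh hK0 hK c legs hV hp t.dirs (hN t ht hc))
    ((t.groups.map fun g => (g.pend : Multiset _)).sum)
  exact h1.trans (mul_le_mul_of_nonneg_left (hmom t ht hc) hKD)

end Law

end Literature.MathematicalPhysics.QuantumFieldTheory.BalabanImbrieJaffe1984to88.BIJ88WalkScaledCutoff309

end
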